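import Summits.Ventures.YMGap.Thresholds.DSWindowCertificate
import HarnessLib

/-!
# Venture YMGap — track (c) «DS»: PARTITION window systems (windows = fibres of a labelling) —
# the received-sum condition per cell and the adapted profile from a distance on labels

HONEST FRAMING: venture file (cell `pub-ymgap`), bookkeeping only; continues
`DSWindowCertificate.lean`. Nothing is certified or asserted about any lattice model here.

When the windows of a Dobrushin–Shlosman window system are the FIBRES of a labelling
`centre : ι → κ` of the cells (`win c = {x : centre x = centre c}` — e.g. lattice gauge theory on an
even torus with `centre ℓ =` the even endpoint of the link `ℓ`: the windows are the vertex STARS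
of the even sites, which partition the links; cell `pub-ymgap` STAR-DOOR.md, R87), the bookkeeping
of the tree door `DobrushinShlosman.abs_covariance_le` collapses:
* every cell lies in its own window, and the windows containing `x` are exactly the cells of the
  fibre of `x` (`filter_mem_fibreWin`), so `N⋆ =` the maximal fibre size;
* for an influence array depending on the centre only through its label, `k c = K (centre c)`,
  the averaged received-sum condition (H2) `IsDSReceivedSum` IS the per-cell condition
  `Σ_y K (centre x) y x ≤ γ₀` (`isDSReceivedSum_fibre`) — "all windows containing `x` are the same
  star" (STAR-DOOR.md §2);
* an adapted profile (`Certificate.Profile`) is `ℓ x = D (centre x)` for any `D : κ → ℕ` vanishing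
  on the labels of `Δg`, `≥ L₀` on the labels of `Δf`, and with `D v ≤ D w + 1` whenever some
  `K v y x ≠ 0` has `centre y = w` (`Certificate.profile_of_fibre`) — in the lattice: the periodic
  sup-distance of the centres, since a boundary link of a star has its centre at sup-distance `1`.

Contents: `fibreWin`, `mem_fibreWin`, `self_mem_fibreWin`, `filter_mem_fibreWin`,
`isDSReceivedSum_fibre`, `Certificate.ofPartition` (constructor: weight, fibre bound `N⋆`, array
`K ≥ 0` with (H1) for the fibre windows, per-cell received sum `≤ γ₀ < 1`),
`Certificate.profile_of_fibre`.

References: R. L. Dobrushin, S. B. Shlosman (1985), condition `C_V` for the translates of one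
block; H. Föllmer, LNM 1362 (1988) Ch. I (2.23) (the distance profile).
-/

noncomputable section

open MeasureTheory ProbabilityTheory Function
open Literature.Probability.LatticeModels

namespace Summit.Ventures.YMGap.DSWindow

variable {ι κ : Type*} [Fintype ι] [DecidableEq ι] [DecidableEq κ]

/-- The **fibre window** of the cell `c` under the labelling `centre`: all cells with the same
label (LGT: the star of the even endpoint of the link `c`). -/
def fibreWin (centre : ι → κ) (c : ι) : Finset ι :=
  Finset.univ.filter fun x => centre x = centre c

omit [DecidableEq ι] in
/-- Membership in a fibre window is equality of labels. -/
@[simp] theorem mem_fibreWin {centre : ι → κ} {c x : ι} :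
    x ∈ fibreWin centre c ↔ centre x = centre c := by
  simp [fibreWin]

omit [DecidableEq ι] in
/-- Every cell lies in its own fibre window (`hself`). -/
theorem self_mem_fibreWin (centre : ι → κ) (x : ι) : x ∈ fibreWin centre x :=
  mem_fibreWin.2 rfl

/-- The windows containing `x` are the cells of the fibre of `x` ("all windows containing a link
are the same star"). -/
theorem filter_mem_fibreWin (centre : ι → κ) (x : ι) :
    (Finset.univ.filter fun c => x ∈ fibreWin centre c) = fibreWin centre x := by
  ext c
  simp [fibreWin, eq_comm]

/-- **(H2) for fibre windows is the per-cell received sum.** If the array depends on the centre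
only through its label, `k c = K (centre c)`, and `Σ_y K (centre x) y x ≤ γ₀` for every cell `x`,
then `IsDSReceivedSum` holds with ratio `γ₀` (both sides carry the factor `#fibre(x)`). -/
theorem isDSReceivedSum_fibre {centre : ι → κ} {K : κ → ι → ι → ℝ} {γ₀ : ℝ}
    (hsum : ∀ x, ∑ y, K (centre x) y x ≤ γ₀) :
    IsDSReceivedSum (fibreWin centre) (fun c => K (centre c)) γ₀ := by
  intro x
  rw [filter_mem_fibreWin]
  calc ∑ c ∈ fibreWin centre x, ∑ y, K (centre c) y x
      = ∑ c ∈ fibreWin centre x, ∑ y, K (centre x) y x :=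
        Finset.sum_congr rfl fun c hc => by rw [mem_fibreWin.1 hc]
    _ = (fibreWin centre x).card * ∑ y, K (centre x) y x := by
        rw [Finset.sum_const, nsmul_eq_mul]
    _ ≤ (fibreWin centre x).card * γ₀ :=
        mul_le_mul_of_nonneg_left (hsum x) (Nat.cast_nonneg _)
    _ = γ₀ * (fibreWin centre x).card := mul_comm _ _

variable {S : Type*} [MeasurableSpace S]

/-- **The partition-window certificate constructor** (cells = sites, `cell = id`): a cell weight
`w ≤ R` local in its cell, a labelling `centre` with fibres of size `≤ Nstar`, a label-indexed
nonnegative array `K` with the window contraction (H1) for the fibre windows, and the PER-CELL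
received sum `Σ_y K (centre x) y x ≤ γ₀ < 1`. -/
def Certificate.ofPartition (γ : Specification ι S) (centre : ι → κ)
    (w : ι → (ι → S) → (ι → S) → ℝ) (R : ℝ) (hR : 0 ≤ R) (hwR : ∀ c σ τ, w c σ τ ≤ R)
    (hwloc : ∀ (c : ι) (σ σ' τ τ' : ι → S), (∀ v, v = c → σ v = σ' v) →
      (∀ v, v = c → τ v = τ' v) → w c σ τ = w c σ' τ')
    (Nstar : ℕ) (hN : ∀ x, (fibreWin centre x).card ≤ Nstar)
    (K : κ → ι → ι → ℝ) (hK : ∀ v y x, 0 ≤ K v y x)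
    (hcontract : IsWindowKRContraction γ id w (fibreWin centre) (fibreWin centre)
      fun c => K (centre c))
    (γ₀ : ℝ) (hγ₀ : 0 ≤ γ₀) (hγ₁ : γ₀ < 1) (hsum : ∀ x, ∑ y, K (centre x) y x ≤ γ₀) :
    Certificate γ (id : ι → ι) where
  w := w
  R := R
  Λ := fibreWin centre
  win := fibreWin centre
  Nstar := Nstar
  k c := K (centre c)
  γ₀ := γ₀
  R_nonneg := hR
  w_le := hwR
  w_local := hwloc
  mem_iff _ _ := Iff.rfl
  self_mem := self_mem_fibreWin centre
  card_le x := by rw [filter_mem_fibreWin]; exact hN x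
  k_nonneg _ _ _ := hK _ _ _
  contract := hcontract
  γ₀_nonneg := hγ₀
  γ₀_lt_one := hγ₁
  receivedSum := isDSReceivedSum_fibre hsum

/-- **The adapted profile of a fibre window system from a distance on labels.** Let `C` be a
certificate whose windows are the fibres of `centre` and whose array is supported on pairs with
`Adj (centre c) (centre y)` (LGT: a boundary link of a star has its centre at periodic sup-distance
`≤ 1` from the star's centre). Then for every `D : κ → ℕ` vanishing on the labels of `Δg`,
non-expanding along `Adj` (`D v ≤ D w + 1`), and `≥ L₀` on the labels of `Δf`, the layer function
`ℓ x = D (centre x)` is an adapted profile (`Certificate.Profile`) at depth `L₀` (Föllmer 1988 Ch. I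
(2.23): the distance profile). -/
theorem Certificate.profile_of_fibre {γ : Specification ι S} (C : Certificate γ (id : ι → ι))
    {centre : ι → κ} (hwin : C.win = fibreWin centre) {Adj : κ → κ → Prop}
    (hk : ∀ c y x, C.k c y x ≠ 0 → Adj (centre c) (centre y)) (D : κ → ℕ) {Δf Δg : Finset ι}
    (hD0 : ∀ z ∈ Δg, D (centre z) = 0) (hD1 : ∀ v w, Adj v w → D v ≤ D w + 1) {L₀ : ℕ}
    (hL : ∀ x ∈ Δf, L₀ ≤ D (centre x)) :
    C.Profile Δf Δg (fun x => D (centre x)) L₀ where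
  avoid x hx c hxc z hzc hzg := by
    rw [hwin] at hxc hzc
    have h1 : centre x = centre c := mem_fibreWin.1 hxc
    have h2 : centre z = centre c := mem_fibreWin.1 hzc
    apply hx
    rw [h1, ← h2]
    exact hD0 z hzg
  step c x y hxc hkc := by
    rw [hwin] at hxc
    have h1 : centre x = centre c := mem_fibreWin.1 hxc
    change D (centre x) ≤ D (centre y) + 1
    rw [h1]
    exact hD1 _ _ (hk c y x hkc)
  le_on := hL

end Summit.Ventures.YMGap.DSWindow

end
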